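import Literature.Algebra.Semigroups.FullTransformationIdempotents

/-!
# Inverse elements in `𝒯ₙ`: the number of inverses of a transformation

Source: O. Ganyushkin, V. Mazorchuk, *Classical Finite Transformation Semigroups*, Algebra and
Applications 9, Springer (2009) [GanyushkinMazorchuk2009], §2.6 Corollary 2.6.5 (ii),
Exercise 2.6.6 (a), and Exercise 2.10.11, for the full transformation monoid
`𝒯(X) = (X → X, ∘)`.

`β` is an *inverse* of `α` (`β ∈ V(α)`) if `αβα = α` and `βαβ = β` (§2.6).  By Theorem 2.6.4
(`inversePair_iff` in `Literature.Algebra.Semigroups.FullTransformationIdempotents`) such a `β`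
is given by a choice `β(a) ∈ α⁻¹(a)` for each `a ∈ im α` together with, for each
`x ∉ im α`, a choice of the point `a ∈ im α` with `β(x) = β(a)`.

* Corollary 2.6.5 (ii): if `im α = {a₁, …, a_k}` with preimage sizes `m₁, …, m_k`, then
  `|V_{𝒯ₙ}(α)| = m₁ ⋯ m_k · k^{n-k}` (`card_inverses`);
* Exercise 2.6.6 (a): `|V_{𝒯ₙ}(0_a)| = n` — the inverses of a constant map are exactly the
  constant maps (`inverses_const`, `card_inverses_const`);
* Exercise 2.10.11: `V(α)α` is a left zero semigroup and `αV(α)` a right zero semigroup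
  (`inverses_mul_left_zero`, `mul_inverses_right_zero`; any semigroup).
-/

namespace Literature.Algebra.Semigroups.FullTransformation

open Function Set

variable {X : Type*}

/-! ### Exercise 2.10.11 (any semigroup) -/

/-- **Exercise 2.10.11**: for inverses `β, γ ∈ V(α)` one has `(βα)(γα) = βα`, i.e. `V(α)α`
is a left zero semigroup. [cite: GanyushkinMazorchuk2009, Exercise 2.10.11] -/
theorem inverses_mul_left_zero {S : Type*} [Semigroup S] {α β γ : S}
    (hγ : α * γ * α = α) : (β * α) * (γ * α) = β * α := by
  calc (β * α) * (γ * α) = β * (α * γ * α) := by simp only [mul_assoc]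
    _ = β * α := by rw [hγ]

/-- **Exercise 2.10.11**: for inverses `β, γ ∈ V(α)` one has `(αβ)(αγ) = αγ`, i.e. `αV(α)`
is a right zero semigroup. [cite: GanyushkinMazorchuk2009, Exercise 2.10.11] -/
theorem mul_inverses_right_zero {S : Type*} [Semigroup S] {α β γ : S}
    (hβ : α * β * α = α) : (α * β) * (α * γ) = α * γ := by
  calc (α * β) * (α * γ) = (α * β * α) * γ := by simp only [mul_assoc]
    _ = α * γ := by rw [hβ]

/-! ### Exercise 2.6.6 (a): inverses of a constant map -/

/-- **Exercise 2.6.6 (a)**: the inverses of the constant map `0_a` in `𝒯(X)` are exactly the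
constant maps `0_b`. [cite: GanyushkinMazorchuk2009, Exercise 2.6.6 (a)] -/
theorem inverses_const [Nonempty X] (a : X) (β : X → X) :
    (const X a ∘ β ∘ const X a = const X a ∧ β ∘ const X a ∘ β = β) ↔ ∃ b, β = const X b := by
  constructor
  · rintro ⟨-, h⟩
    exact ⟨β a, funext fun x => (congrFun h x).symm⟩
  · rintro ⟨b, rfl⟩
    exact ⟨rfl, rfl⟩

/-- **Exercise 2.6.6 (a)**: `|V_{𝒯ₙ}(0_a)| = n`. [cite: GanyushkinMazorchuk2009, Exercise 2.6.6 (a)] -/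
theorem card_inverses_const [Nonempty X] (a : X) :
    {β : X → X | const X a ∘ β ∘ const X a = const X a ∧ β ∘ const X a ∘ β = β}.ncard =
      Nat.card X := by
  have h : {β : X → X | const X a ∘ β ∘ const X a = const X a ∧ β ∘ const X a ∘ β = β} =
      range (fun b : X => const X b) := by
    ext β
    rw [mem_setOf_eq, inverses_const, mem_range]
    simp only [eq_comm]
  rw [h, ncard_range_of_injective]
  intro b b' hbb'
  inhabit X
  exact congrFun hbb' default

/-! ### Corollary 2.6.5 (ii): the number of inverses -/

/-- **Corollary 2.6.5 (ii)**: for `α ∈ 𝒯ₙ` with image `{a₁, …, a_k}` and `m_i = |α⁻¹(a_i)|`,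
the number of inverses of `α` in `𝒯ₙ` is `m₁ m₂ ⋯ m_k · k^{n-k}`: an inverse `β` is an
independent choice of `β(a_i) ∈ α⁻¹(a_i)` and, on `N \ im α`, of an arbitrary map into the
`k`-element set `β(im α)` (Theorem 2.6.4). [cite: GanyushkinMazorchuk2009, Corollary 2.6.5 (ii)] -/
theorem card_inverses [Fintype X] [DecidableEq X] (α : X → X) :
    Fintype.card {β : X → X // α ∘ β ∘ α = α ∧ β ∘ α ∘ β = β} =
      (∏ a ∈ Finset.univ.image α, (Finset.univ.filter fun x => α x = a).card) *
        (Finset.univ.image α).card ^ (Fintype.card X - (Finset.univ.image α).card) := by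
  set A := Finset.univ.image α with hA
  have hmemA : ∀ x, α x ∈ A := fun x => Finset.mem_image_of_mem α (Finset.mem_univ x)
  have hA' : ∀ {a}, a ∈ A ↔ a ∈ range α := by
    intro a
    simp [hA, Finset.mem_image]
  -- the bijection `V(α) ≃ (Π a ∈ im α, α⁻¹(a)) × (N \ im α → im α)`
  let e : {β : X → X // α ∘ β ∘ α = α ∧ β ∘ α ∘ β = β} ≃
      ((a : A) → {x : X // α x = a}) × (↥(Aᶜ) → A) :=
    { toFun := fun β =>
        (fun a => ⟨β.1 a, ((inversePair_iff α β.1).1 β.2).1 a (hA'.1 a.2)⟩,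
          fun x => ⟨α (β.1 x), hmemA _⟩)
      invFun := fun p =>
        ⟨fun x => if h : x ∈ A then (p.1 ⟨x, h⟩ : X)
            else (p.1 (p.2 ⟨x, Finset.mem_compl.2 h⟩) : X), by
          rw [inversePair_iff]
          constructor
          · intro a ha
            have haA : a ∈ A := hA'.2 ha
            simp only [dif_pos haA]
            exact (p.1 ⟨a, haA⟩).2
          · refine Subset.antisymm ?_ ?_
            · rintro _ ⟨x, rfl⟩
              dsimp only
              by_cases hx : x ∈ A
              · exact ⟨x, hA'.1 hx, rfl⟩
              · rw [dif_neg hx]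
                refine ⟨(p.2 ⟨x, Finset.mem_compl.2 hx⟩ : X), hA'.1 (p.2 _).2, ?_⟩
                dsimp only
                rw [dif_pos (p.2 _).2]
            · exact image_subset_range _ _⟩
      left_inv := by
        rintro ⟨β, hβ⟩
        apply Subtype.ext
        funext x
        dsimp only
        by_cases hx : x ∈ A
        · rw [dif_pos hx]
        · rw [dif_neg hx]
          -- `β x = β (α (β x))` since `βαβ = β`
          exact (congrFun hβ.2 x)
      right_inv := by
        rintro ⟨c, g⟩
        ext a
        · dsimp only
          rw [dif_pos a.2]
        · dsimp only
          have hx : (a : X) ∉ A := Finset.mem_compl.1 a.2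
          rw [dif_neg hx]
          exact (c (g a)).2 }
  rw [Fintype.card_congr e, Fintype.card_prod, Fintype.card_pi, Fintype.card_fun,
    Fintype.card_coe, Fintype.card_coe, Finset.card_compl]
  congr 1
  rw [← Finset.prod_coe_sort A]
  refine Finset.prod_congr rfl fun a _ => ?_
  rw [Fintype.card_subtype]

end Literature.Algebra.Semigroups.FullTransformation
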